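import Summits.BirchSwinnertonDyer.BirchSwinnertonDyer.Theorems.TameQuarticManinParityTprimeHeegnerUpperOfManinUnitComposition
import Summits.BirchSwinnertonDyer.BirchSwinnertonDyer.Theorems.TameQuarticManinParityTprimeHeegnerUpperOfManinUnitSigmaSwapCarrierBlind
import HarnessLib

/-!
# Crux X₄ `TprimeHeegnerUpperOfManinUnit` (stmt-BirchSwinnertonDyer-23738; TQMP r4 / TQS r303), line `rows_of_manin_unit` v2
# (3c59fc8b80b3): THE CRUX BY NAME MODULO ITS v3-SHAPED INPUTS — print ⊕ p-stub ⊕ three NAMED Literature facts {Gross 3.7 (2),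
# Poitou–Tate, GZ86 III (3.1) image-free} ⊕ Σ⁺₂ (the increment beyond `m_max` on 2-split Heegner frames: ≥ 2 Tamagawa-`3` carriers
# only) ⊕ KT 19981 ⊕ r₃ — NO reading stub — kernel accounting for the route pen

HONEST FRAMING. Theorems only; helper file (`--supports stmt-BirchSwinnertonDyer-23738 --as helper`, leafhand `leafhand-bsd-tamequarticmaninpa-5`
g0, 2026-08-31); no definition, no named fact, no `sorry`; CONDITIONAL on every displayed input; nothing booked, no stub closed BY NAME, no
item closed, 23738 stays OPEN, BSD proved for no curve. Seventh file of this seat: p823868's composition re-run with its Σ-at-datum socket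
replaced by the 2-split socket of `…SigmaSwapCarrierBlind` (§3 there), so that the research stub Σ is REPLACED by the three named facts (which pay
every depth `s′ ≤ ord₃ c_q(E)` at ANY carrier `q`, potss's swap walk + this seat's carrier-blind node) plus the increment Σ⁺₂. This module imports
the route cone through `…Composition` (which imports `Theses.TameQuarticSolvent` / `Theses.TameQuarticManinParity` to conclude the decls BY
NAME), exactly as the registered skeleton does.

* §1 `tprime_upper_three_rankOne_of_maninUnits_of_reduce_of_namedFacts_of_increment_of_lowerRankZero_of_reducibleRows` — p823868's core with
  Σ ↦ {`h37 hPT hF1`, Σ⁺₂}: PRINT + Manin units (`hMi hMr`) + p-stub + three facts + Σ⁺₂ + L₀ + r₃ ⟹ the typed upper half at `3` on every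
  non-CM (t′) rank-one curve.
* §2 `tprimeHeegnerUpperOfManinUnit_tqs_of_reduce_of_namedFacts_of_increment_of_tameLowerHalfRankZero_of_reducibleRows` — the registered
  `crux_decl` `TameQuarticSolvent.TprimeHeegnerUpperOfManinUnit` BY NAME ⟸ PRINT (7) + p-stub VERBATIM + three facts + Σ⁺₂ + KT 19981 BY NAME +
  r₃ VERBATIM; and the TQMP twin `tprimeHeegnerUpperOfManinUnit_of_reduce_of_namedFacts_of_increment_…`.
WHAT THIS SAYS (count-neutral): the research content of 23738 on the irreducible rows is Σ⁺₂ ALONE — «on a Heegner frame of a non-CM (t′)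
rank-one curve with `E[3]` irreducible in a field where `2` splits, `3^{s′} ∣ P_n` for `max_q ord₃ c_q(E) < s′ ≤ ord₃ ∏ c_ℓ(E)`» (open in
print at any `p`: Jetchev Conj. 1.3 beyond Thm. 1.4; Büyükboduk 2009 §4.2 Q1) — plus r₃ (reducible rows) and L₀ (KT 19981); a v3 cut is the
pen's call (this hand registers nothing).
References: [cite: Jetchev2008, Thm. 1.4 (p. 812), Conj. 1.3] [cite: Buyukboduk2009TamagawaDefect, §4.2 Question 1] [cite: MatarNekovar2019, Thm. 0.7, §0.11]
[cite: GrossLMS1991, Prop. 3.7 (2), §6 p. 245] [cite: GrossZagier1986, III (3.1), Thm. I.(6.3), (7.3)] [cite: FriedbergHoffstein1995, Thm. B]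
[cite: Kato2004Asterisque, Thm. 17.4] [cite: CastellaGrossiLeeSkinner2022, Thm. A] [cite: Miller2011LMS, Def. 1.1].
presearch (D-0021): pure composition of tree theorems (p823868's core re-keyed; this seat's `…SigmaSwapCarrierBlind`); no new source needed.
-/

-- D-0017: single-problem summit, so `Summit.BirchSwinnertonDyer.BirchSwinnertonDyer.…` repeats a namespace BY DESIGN.
set_option linter.dupNamespace false
set_option autoImplicit false

noncomputable section

open scoped Classical NumberField

open WeierstrassCurve IsDedekindDomain NumberField Literature Literature.NumberTheory.EllipticCurves
  Literature.NumberTheory.EllipticCurves.ModularForms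
  Literature.NumberTheory.EllipticCurves.Rank1Residual
  Literature.NumberTheory.EllipticCurves.Rank1Residual.Typed
  Literature.NumberTheory.GaloisCohomology
  Summit.BirchSwinnertonDyer.Rank1Residual
  Summit.BirchSwinnertonDyer.Rank1Residual.Additive
  Summit.BirchSwinnertonDyer.Rank1Residual.X11b
  Summit.BirchSwinnertonDyer.Rank1Residual.X11b.Three
  Summit.BirchSwinnertonDyer.BirchSwinnertonDyer.Theses
  Summit.BirchSwinnertonDyer.BirchSwinnertonDyer.Theorems

namespace Summit.BirchSwinnertonDyer.BirchSwinnertonDyer.Theorems.TprimeHeegnerUpperOfManinUnit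

/-! ## §1 The typed upper half on every non-CM (t′) rank-one curve ⟸ PRINT + Manin units + p-stub + three facts + Σ⁺₂ + L₀ + r₃ -/

/-- **THE CORE OF p823868 WITH Σ REPLACED BY {three named facts, Σ⁺₂}.** For every non-CM (t′) curve of analytic rank one,
`Typed.MissingUpperBoundAt W 3` follows from: PRINT (`hGZ hKo hGZK hGZ73 hMN hnf hFH`), the Manin units on optimal data of 23736 / 23737 (`hMi`,
`hMr`, VERBATIM antecedents of the crux), the p-stub `stub_reduceToOptimalDatum` (`hRed`, VERBATIM), the NAMED Literature facts `h37` (Gross 1991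
Prop. 3.7 (2)), `hPT` (Poitou–Tate, ∀ K), `hF1` ([GZ86 III (3.1)] image-free), the INCREMENT ON 2-SPLIT FRAMES Σ⁺₂ (`hIncr`: Σ's binders +
`SatisfiesHeegnerHypothesis 2 K` + the depth clause «every prime `q ∣ N_E` has `ord₃ c_q < s′`» — non-vacuous only on the rows with ≥ 2
Tamagawa-`3` carriers), the non-CM (t′) rank-ZERO lower half at `3` (`hL0`) and r₃ (`hR3`, VERBATIM). NO reading stub. Proof = p823868's
core with the socket replaced by `tprime_upper_three_of_irreducible_of_sigmaAtDatumTwoSplit_of_lowerRankZero` (`…SigmaSwapCarrierBlind` §3)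
and, per depth, `pDiv_of_dvd_level_of_heegnerFrame_twoSplit_of_namedFacts` (some carrier pays) or Σ⁺₂. CONDITIONAL on every displayed input;
credits nothing. [cite: Jetchev2008, Thm. 1.4 (p. 812), Conj. 1.3] [cite: MatarNekovar2019, Thm. 0.7 (p. 456), §0.11 (p. 457)]
[cite: GrossLMS1991, Prop. 3.7 (2), §6 p. 245] [cite: FriedbergHoffstein1995, Thm. B] [cite: Miller2011LMS, Def. 1.1] -/
theorem tprime_upper_three_rankOne_of_maninUnits_of_reduce_of_namedFacts_of_increment_of_lowerRankZero_of_reducibleRows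
    (hGZ : ∀ (N : ℕ) [NeZero N] (W : WeierstrassCurve ℚ) (K : Type) [Field K] [NumberField K],
      gross_zagier N W K)
    (hKo : ∀ (N : ℕ) [NeZero N] (W : WeierstrassCurve ℚ) (K : Type) [Field K] [NumberField K],
      kolyvagin N W K)
    (hGZK : rank_eq_analyticRank_of_analyticRank_le_one) (hGZ73 : GrossZagier1986_thm_I_7_3)
    (hMN : MatarNekovar2019.thm07_padicValNat_card_sha_primary_add_le_of_globalDivisibility_of_irreducible)
    (hnf : exists_isNewformOf) (hFH : friedbergHoffstein_exists_heegnerField_splitDivisors_twist_ne_zero)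
    (hMi : ∀ (W : WeierstrassCurve ℚ) [W.IsElliptic] [W.IsGloballyMinimal] [NeZero (W.conductorNorm ℤ)],
      ¬ W.HasCM → Addv W 3 → SubTprime W 3 → W.HasIrreducibleModPGaloisRep 3 →
      ∀ (D : ModularParametrizationData W (W.conductorNorm ℤ)),
        (∀ z ∈ D.L.lattice, ∃ w ∈ periodLattice D.f, z = D.c * w) →
        (∀ (W' : WeierstrassCurve ℚ) [W'.IsElliptic] (D' : ModularParametrizationData W' (W.conductorNorm ℤ)),
          D'.f = D.f → D.modularDegree ≤ D'.modularDegree) →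
        ¬ (3 : ℤ) ∣ D.maninConstant)
    (hMr : ∀ (W : WeierstrassCurve ℚ) [W.IsElliptic] [W.IsGloballyMinimal] [NeZero (W.conductorNorm ℤ)],
      ¬ W.HasCM → Addv W 3 → SubTprime W 3 → ¬ W.HasIrreducibleModPGaloisRep 3 →
      ∀ (D : ModularParametrizationData W (W.conductorNorm ℤ)),
        (∀ z ∈ D.L.lattice, ∃ w ∈ periodLattice D.f, z = D.c * w) →
        (∀ (W' : WeierstrassCurve ℚ) [W'.IsElliptic] (D' : ModularParametrizationData W' (W.conductorNorm ℤ)),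
          D'.f = D.f → D.modularDegree ≤ D'.modularDegree) →
        ¬ (3 : ℤ) ∣ D.maninConstant)
    (hRed : (∀ (W : WeierstrassCurve ℚ) [W.IsElliptic] [W.IsGloballyMinimal] [NeZero (W.conductorNorm ℤ)],
        ¬ W.HasCM → Rank1Residual.Addv W 3 → Summit.BirchSwinnertonDyer.Rank1Residual.Additive.SubTprime W 3 →
        W.analyticRank = 1 →
        ∀ (D : ModularParametrizationData W (W.conductorNorm ℤ)),
          (∀ z ∈ D.L.lattice, ∃ w ∈ periodLattice D.f, z = D.c * w) →
          (∀ (W' : WeierstrassCurve ℚ) [W'.IsElliptic] (D' : ModularParametrizationData W' (W.conductorNorm ℤ)),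
              D'.f = D.f → D.modularDegree ≤ D'.modularDegree) →
          Rank1Residual.Typed.MissingUpperBoundAt W 3) →
      ∀ (W : WeierstrassCurve ℚ) [W.IsElliptic] [W.IsGloballyMinimal],
        ¬ W.HasCM → Rank1Residual.Addv W 3 → Summit.BirchSwinnertonDyer.Rank1Residual.Additive.SubTprime W 3 →
        W.analyticRank = 1 → Rank1Residual.Typed.MissingUpperBoundAt W 3)
    (h37 : GrossLMS1991.prop37_2_frobeniusCongruence)
    (hPT : ∀ (K : Type) [Field K] [NumberField K], poitouTate_selmerStructure_duality_conj K)
    (hF1 : Gross1991_heegnerPoint_sub_ratTorsion_mem_E0_imageFree)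
    (hIncr : ∀ (W : WeierstrassCurve ℚ) [W.IsElliptic] [W.IsGloballyMinimal] [NeZero (W.conductorNorm ℤ)]
      (K : Type) [Field K] [NumberField K] (Dt : ModularParametrizationData W (W.conductorNorm ℤ))
      (H : HeegnerDatum (W.conductorNorm ℤ) (NumberField.discr K)) (ι : K →+* ℂ) (P : (W.baseChange K).toAffine.Point),
      ¬ W.HasCM → Addv W 3 → SubTprime W 3 → W.HasIrreducibleModPGaloisRep 3 → W.analyticRank = 1 →
      ¬ (3 : ℤ) ∣ Dt.c → IsImaginaryQuadratic K → SatisfiesHeegnerHypothesis (W.conductorNorm ℤ) K →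
      SatisfiesHeegnerHypothesis 2 K →
      (W.quadraticTwist (NumberField.discr K : ℚ)).entireLFunction 1 ≠ 0 →
      WeierstrassCurve.Affine.Point.map ι.toRatAlgHom P = heegnerPointComplex Dt H → ¬ IsOfFinAddOrder P →
      Odd (NumberField.discr K) →
      ∀ (s' : ℕ), (∀ (q : ℕ) [Fact q.Prime], q ∣ W.conductorNorm ℤ →
          padicValNat 3 ((W.baseChange ℚ_[q]).localTamagawaNumber ℤ_[q]) < s') →
      s' ≤ padicValNat 3 W.tamagawaProduct →
      ∀ (n : ℕ) (d : KolyvaginHeegnerData Dt H.β ι n), Squarefree n →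
      (∀ ℓ ∈ n.primeFactors, Zhang2014.IsKolyvaginPrime (W.conductorNorm ℤ) W K 3 ℓ ∧
        s' ≤ Zhang2014.kolyvaginIndex W 3 ℓ) → Koly.PDiv d 3 s')
    (hL0 : ∀ (V : WeierstrassCurve ℚ) [V.IsElliptic] [V.IsGloballyMinimal],
      ¬ V.HasCM → Addv V 3 → SubTprime V 3 → V.analyticRank = 0 → MissingLowerBoundAt V 3)
    (hR3 : ∀ (W : WeierstrassCurve ℚ) [W.IsElliptic] [W.IsGloballyMinimal] [NeZero (W.conductorNorm ℤ)],
      ¬ W.HasCM → Rank1Residual.Addv W 3 → Summit.BirchSwinnertonDyer.Rank1Residual.Additive.SubTprime W 3 →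
      ¬ W.HasIrreducibleModPGaloisRep 3 → W.analyticRank = 1 →
      ∀ (D : ModularParametrizationData W (W.conductorNorm ℤ)), ¬ (3 : ℤ) ∣ D.maninConstant →
        Rank1Residual.Typed.MissingUpperBoundAt W 3) :
    ∀ (W : WeierstrassCurve ℚ) [W.IsElliptic] [W.IsGloballyMinimal],
      ¬ W.HasCM → Rank1Residual.Addv W 3 → Summit.BirchSwinnertonDyer.Rank1Residual.Additive.SubTprime W 3 →
      W.analyticRank = 1 → Rank1Residual.Typed.MissingUpperBoundAt W 3 := by
  haveI : Fact (Nat.Prime 3) := ⟨Nat.prime_three⟩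
  have hmod : hasEntireLFunction_rat := hasEntireLFunction_rat_of_exists_isNewformOf hnf
  intro W _ _ hCM hadd hsub hr
  refine hRed ?_ W hCM hadd hsub hr
  intro W₀ _ _ _ hCM₀ hadd₀ hsub₀ hr₀ D₀ hlat hmin
  by_cases hirr : W₀.HasIrreducibleModPGaloisRep 3
  · -- irreducible optimal rows: the Manin unit of 23736 sets the Σ-depth to `ord₃ ∏ c_ℓ`; the socket asks Σ only in 2-split fields
    have hc : ¬ (3 : ℤ) ∣ D₀.c := hMi W₀ hCM₀ hadd₀ hsub₀ hirr D₀ hlat hmin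
    refine tprime_upper_three_of_irreducible_of_sigmaAtDatumTwoSplit_of_lowerRankZero hGZ hKo hGZK hmod hGZ73 hMN hnf hFH hL0
      W₀ hCM₀ hadd₀ hsub₀ hirr hr₀ D₀ ?_
    have hc0 : padicValNat 3 D₀.c.natAbs = 0 :=
      padicValNat.eq_zero_of_not_dvd fun h ↦ hc (Int.ofNat_dvd_left.mpr h)
    have h3N : 3 ∣ W₀.conductorNorm ℤ :=
      (W₀.dvd_conductorNorm_iff_not_hasGoodReductionAtPrime 3).mpr (not_good_of_addv W₀ 3 hadd₀)
    intro K _ _ H ι P hK hHN h2K hLt hP hnt hodd s' hs' n d hn hℓ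
    -- per depth: some carrier pays it (three named facts, 2-split frame) or it lies beyond every carrier (Σ⁺₂)
    by_cases hq : ∃ (q : ℕ) (_ : Fact q.Prime), q ∣ W₀.conductorNorm ℤ ∧
        s' ≤ padicValNat 3 ((W₀.baseChange ℚ_[q]).localTamagawaNumber ℤ_[q])
    · obtain ⟨q, _, hqN, hsq⟩ := hq
      have h3 : NumberField.discr K ≠ -3 := by
        intro h
        exact (X11b.Three.not_dvd_discr_and_not_dvd_torsionOrder_of_heegner hK hHN (by decide) h3N).1
          (h ▸ ⟨-1, by norm_num⟩)
      have h4 : NumberField.discr K ≠ -4 := by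
        intro h
        rw [h] at hodd
        exact (Int.not_odd_iff_even.mpr ⟨-2, by norm_num⟩) hodd
      exact pDiv_of_dvd_level_of_heegnerFrame_twoSplit_of_namedFacts h37 hPT hF1 W₀ hCM₀ K hK h3 h4 hHN h2K 3 (by decide)
        hirr h3N D₀ H ι P hP hnt q hqN s' hsq n d hn hℓ
    · push Not at hq
      exact hIncr W₀ K D₀ H ι P hCM₀ hadd₀ hsub₀ hirr hr₀ hc hK hHN h2K hLt hP hnt hodd s' (fun q hq' hqN ↦ hq q hq' hqN)
        (by omega) n d hn hℓ
  · -- reducible optimal rows: the Manin unit of 23737 feeds the reducible stub r₃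
    exact hR3 W₀ hCM₀ hadd₀ hsub₀ hirr hr₀ D₀ (hMr W₀ hCM₀ hadd₀ hsub₀ hirr D₀ hlat hmin)

/-! ## §2 The crux BY NAME (TQS crux_decl and TQMP twin) modulo its v3-shaped inputs — NO reading stub -/

/-- **THE REGISTERED `crux_decl` `TameQuarticSolvent.TprimeHeegnerUpperOfManinUnit` (item 23738) BY NAME ⟸ PRINT (7) + p-stub
`stub_reduceToOptimalDatum` (VERBATIM) + three NAMED Literature facts {Gross 3.7 (2), Poitou–Tate, GZ86 III (3.1) image-free} + Σ⁺₂ (the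
increment beyond `m_max` on 2-split Heegner frames; ≥ 2 Tamagawa-`3` carriers only) + route KT's item 19981 BY NAME + r₃ (VERBATIM).** The
crux's own antecedents (23736 / 23737) supply the Manin units. Count-neutral kernel accounting: a v3 cut of line `rows_of_manin_unit` with
Σ ↦ Σ⁺₂ is kernel-ready (the pen's call; this hand registers nothing); the research content of 23738 is {Σ⁺₂, r₃} ⊕ L₀ ⊕ print/p-stub.
CONDITIONAL; credits nothing; 23738 stays OPEN; BSD is proved for no curve. [cite: Jetchev2008, Thm. 1.4 (p. 812), Conj. 1.3]
[cite: Buyukboduk2009TamagawaDefect, §4.2 Question 1] [cite: MatarNekovar2019, Thm. 0.7, §0.11] [cite: GrossLMS1991, Prop. 3.7 (2), §6 p. 245]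
[cite: Kato2004Asterisque, Thm. 17.4] [cite: CastellaGrossiLeeSkinner2022, Thm. A] -/
theorem tprimeHeegnerUpperOfManinUnit_tqs_of_reduce_of_namedFacts_of_increment_of_tameLowerHalfRankZero_of_reducibleRows
    (hGZ : ∀ (N : ℕ) [NeZero N] (W : WeierstrassCurve ℚ) (K : Type) [Field K] [NumberField K],
      gross_zagier N W K)
    (hKo : ∀ (N : ℕ) [NeZero N] (W : WeierstrassCurve ℚ) (K : Type) [Field K] [NumberField K],
      kolyvagin N W K)
    (hGZK : rank_eq_analyticRank_of_analyticRank_le_one) (hGZ73 : GrossZagier1986_thm_I_7_3)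
    (hMN : MatarNekovar2019.thm07_padicValNat_card_sha_primary_add_le_of_globalDivisibility_of_irreducible)
    (hnf : exists_isNewformOf) (hFH : friedbergHoffstein_exists_heegnerField_splitDivisors_twist_ne_zero)
    (hRed : (∀ (W : WeierstrassCurve ℚ) [W.IsElliptic] [W.IsGloballyMinimal] [NeZero (W.conductorNorm ℤ)],
        ¬ W.HasCM → Rank1Residual.Addv W 3 → Summit.BirchSwinnertonDyer.Rank1Residual.Additive.SubTprime W 3 →
        W.analyticRank = 1 →
        ∀ (D : ModularParametrizationData W (W.conductorNorm ℤ)),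
          (∀ z ∈ D.L.lattice, ∃ w ∈ periodLattice D.f, z = D.c * w) →
          (∀ (W' : WeierstrassCurve ℚ) [W'.IsElliptic] (D' : ModularParametrizationData W' (W.conductorNorm ℤ)),
              D'.f = D.f → D.modularDegree ≤ D'.modularDegree) →
          Rank1Residual.Typed.MissingUpperBoundAt W 3) →
      ∀ (W : WeierstrassCurve ℚ) [W.IsElliptic] [W.IsGloballyMinimal],
        ¬ W.HasCM → Rank1Residual.Addv W 3 → Summit.BirchSwinnertonDyer.Rank1Residual.Additive.SubTprime W 3 →
        W.analyticRank = 1 → Rank1Residual.Typed.MissingUpperBoundAt W 3)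
    (h37 : GrossLMS1991.prop37_2_frobeniusCongruence)
    (hPT : ∀ (K : Type) [Field K] [NumberField K], poitouTate_selmerStructure_duality_conj K)
    (hF1 : Gross1991_heegnerPoint_sub_ratTorsion_mem_E0_imageFree)
    (hIncr : ∀ (W : WeierstrassCurve ℚ) [W.IsElliptic] [W.IsGloballyMinimal] [NeZero (W.conductorNorm ℤ)]
      (K : Type) [Field K] [NumberField K] (Dt : ModularParametrizationData W (W.conductorNorm ℤ))
      (H : HeegnerDatum (W.conductorNorm ℤ) (NumberField.discr K)) (ι : K →+* ℂ) (P : (W.baseChange K).toAffine.Point),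
      ¬ W.HasCM → Addv W 3 → SubTprime W 3 → W.HasIrreducibleModPGaloisRep 3 → W.analyticRank = 1 →
      ¬ (3 : ℤ) ∣ Dt.c → IsImaginaryQuadratic K → SatisfiesHeegnerHypothesis (W.conductorNorm ℤ) K →
      SatisfiesHeegnerHypothesis 2 K →
      (W.quadraticTwist (NumberField.discr K : ℚ)).entireLFunction 1 ≠ 0 →
      WeierstrassCurve.Affine.Point.map ι.toRatAlgHom P = heegnerPointComplex Dt H → ¬ IsOfFinAddOrder P →
      Odd (NumberField.discr K) →
      ∀ (s' : ℕ), (∀ (q : ℕ) [Fact q.Prime], q ∣ W.conductorNorm ℤ →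
          padicValNat 3 ((W.baseChange ℚ_[q]).localTamagawaNumber ℤ_[q]) < s') →
      s' ≤ padicValNat 3 W.tamagawaProduct →
      ∀ (n : ℕ) (d : KolyvaginHeegnerData Dt H.β ι n), Squarefree n →
      (∀ ℓ ∈ n.primeFactors, Zhang2014.IsKolyvaginPrime (W.conductorNorm ℤ) W K 3 ℓ ∧
        s' ≤ Zhang2014.kolyvaginIndex W 3 ℓ) → Koly.PDiv d 3 s')
    (hKT : KatoDescentTamePotSupersingular.TameLowerHalfRankZero)
    (hR3 : ∀ (W : WeierstrassCurve ℚ) [W.IsElliptic] [W.IsGloballyMinimal] [NeZero (W.conductorNorm ℤ)],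
      ¬ W.HasCM → Rank1Residual.Addv W 3 → Summit.BirchSwinnertonDyer.Rank1Residual.Additive.SubTprime W 3 →
      ¬ W.HasIrreducibleModPGaloisRep 3 → W.analyticRank = 1 →
      ∀ (D : ModularParametrizationData W (W.conductorNorm ℤ)), ¬ (3 : ℤ) ∣ D.maninConstant →
        Rank1Residual.Typed.MissingUpperBoundAt W 3) :
    TameQuarticSolvent.TprimeHeegnerUpperOfManinUnit := fun hMi hMr ↦
  tprime_upper_three_rankOne_of_maninUnits_of_reduce_of_namedFacts_of_increment_of_lowerRankZero_of_reducibleRows hGZ hKo hGZK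
    hGZ73 hMN hnf hFH hMi hMr hRed h37 hPT hF1 hIncr (tprimeLowerRankZero_three_of_tameLowerHalfRankZero hKT) hR3

/-- **The `TameQuarticManinParity` twin** (same item 23738, wanted_by TQMP r4) BY NAME from the same displayed inputs. CONDITIONAL; credits
nothing. [cite: Jetchev2008, Thm. 1.4 (p. 812), Conj. 1.3] [cite: MatarNekovar2019, Thm. 0.7 (p. 456)] -/
theorem tprimeHeegnerUpperOfManinUnit_of_reduce_of_namedFacts_of_increment_of_tameLowerHalfRankZero_of_reducibleRows
    (hGZ : ∀ (N : ℕ) [NeZero N] (W : WeierstrassCurve ℚ) (K : Type) [Field K] [NumberField K],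
      gross_zagier N W K)
    (hKo : ∀ (N : ℕ) [NeZero N] (W : WeierstrassCurve ℚ) (K : Type) [Field K] [NumberField K],
      kolyvagin N W K)
    (hGZK : rank_eq_analyticRank_of_analyticRank_le_one) (hGZ73 : GrossZagier1986_thm_I_7_3)
    (hMN : MatarNekovar2019.thm07_padicValNat_card_sha_primary_add_le_of_globalDivisibility_of_irreducible)
    (hnf : exists_isNewformOf) (hFH : friedbergHoffstein_exists_heegnerField_splitDivisors_twist_ne_zero)
    (hRed : (∀ (W : WeierstrassCurve ℚ) [W.IsElliptic] [W.IsGloballyMinimal] [NeZero (W.conductorNorm ℤ)],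
        ¬ W.HasCM → Rank1Residual.Addv W 3 → Summit.BirchSwinnertonDyer.Rank1Residual.Additive.SubTprime W 3 →
        W.analyticRank = 1 →
        ∀ (D : ModularParametrizationData W (W.conductorNorm ℤ)),
          (∀ z ∈ D.L.lattice, ∃ w ∈ periodLattice D.f, z = D.c * w) →
          (∀ (W' : WeierstrassCurve ℚ) [W'.IsElliptic] (D' : ModularParametrizationData W' (W.conductorNorm ℤ)),
              D'.f = D.f → D.modularDegree ≤ D'.modularDegree) →
          Rank1Residual.Typed.MissingUpperBoundAt W 3) →
      ∀ (W : WeierstrassCurve ℚ) [W.IsElliptic] [W.IsGloballyMinimal],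
        ¬ W.HasCM → Rank1Residual.Addv W 3 → Summit.BirchSwinnertonDyer.Rank1Residual.Additive.SubTprime W 3 →
        W.analyticRank = 1 → Rank1Residual.Typed.MissingUpperBoundAt W 3)
    (h37 : GrossLMS1991.prop37_2_frobeniusCongruence)
    (hPT : ∀ (K : Type) [Field K] [NumberField K], poitouTate_selmerStructure_duality_conj K)
    (hF1 : Gross1991_heegnerPoint_sub_ratTorsion_mem_E0_imageFree)
    (hIncr : ∀ (W : WeierstrassCurve ℚ) [W.IsElliptic] [W.IsGloballyMinimal] [NeZero (W.conductorNorm ℤ)]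
      (K : Type) [Field K] [NumberField K] (Dt : ModularParametrizationData W (W.conductorNorm ℤ))
      (H : HeegnerDatum (W.conductorNorm ℤ) (NumberField.discr K)) (ι : K →+* ℂ) (P : (W.baseChange K).toAffine.Point),
      ¬ W.HasCM → Addv W 3 → SubTprime W 3 → W.HasIrreducibleModPGaloisRep 3 → W.analyticRank = 1 →
      ¬ (3 : ℤ) ∣ Dt.c → IsImaginaryQuadratic K → SatisfiesHeegnerHypothesis (W.conductorNorm ℤ) K →
      SatisfiesHeegnerHypothesis 2 K →
      (W.quadraticTwist (NumberField.discr K : ℚ)).entireLFunction 1 ≠ 0 →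
      WeierstrassCurve.Affine.Point.map ι.toRatAlgHom P = heegnerPointComplex Dt H → ¬ IsOfFinAddOrder P →
      Odd (NumberField.discr K) →
      ∀ (s' : ℕ), (∀ (q : ℕ) [Fact q.Prime], q ∣ W.conductorNorm ℤ →
          padicValNat 3 ((W.baseChange ℚ_[q]).localTamagawaNumber ℤ_[q]) < s') →
      s' ≤ padicValNat 3 W.tamagawaProduct →
      ∀ (n : ℕ) (d : KolyvaginHeegnerData Dt H.β ι n), Squarefree n →
      (∀ ℓ ∈ n.primeFactors, Zhang2014.IsKolyvaginPrime (W.conductorNorm ℤ) W K 3 ℓ ∧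
        s' ≤ Zhang2014.kolyvaginIndex W 3 ℓ) → Koly.PDiv d 3 s')
    (hKT : KatoDescentTamePotSupersingular.TameLowerHalfRankZero)
    (hR3 : ∀ (W : WeierstrassCurve ℚ) [W.IsElliptic] [W.IsGloballyMinimal] [NeZero (W.conductorNorm ℤ)],
      ¬ W.HasCM → Rank1Residual.Addv W 3 → Summit.BirchSwinnertonDyer.Rank1Residual.Additive.SubTprime W 3 →
      ¬ W.HasIrreducibleModPGaloisRep 3 → W.analyticRank = 1 →
      ∀ (D : ModularParametrizationData W (W.conductorNorm ℤ)), ¬ (3 : ℤ) ∣ D.maninConstant →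
        Rank1Residual.Typed.MissingUpperBoundAt W 3) :
    TameQuarticManinParity.TprimeHeegnerUpperOfManinUnit := fun hMi hMr ↦
  tprime_upper_three_rankOne_of_maninUnits_of_reduce_of_namedFacts_of_increment_of_lowerRankZero_of_reducibleRows hGZ hKo hGZK
    hGZ73 hMN hnf hFH hMi hMr hRed h37 hPT hF1 hIncr (tprimeLowerRankZero_three_of_tameLowerHalfRankZero hKT) hR3

end Summit.BirchSwinnertonDyer.BirchSwinnertonDyer.Theorems.TprimeHeegnerUpperOfManinUnit

end
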